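import Literature.AnabelianGeometry.SemiGraphs.TemperedReconstructionReductionsProofsAt
import Literature.AnabelianGeometry.SemiGraphs.TemperedReconstructionCor39UpToTwistProofsAt
import Literature.AnabelianGeometry.SemiGraphs.TemperedCompactInVerticialFinite
import HarnessLib

/-!
# [SemiAnbd] Cor. 3.9, proof steps (R0) and (R3): the INSTANCE FORMS at the genuine carrier

Mochizuki, *Semi-graphs of anabelioids*, Publ. RIMS **42** (2006), §3, Corollary 3.9 and its proof,
manuscript pp. 42–43 [cite: MochizukiSemiAnbd2006, Cor 3.9 pp.42-43]: (R0) "any locally open morphism of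
semi-graphs of anabelioids `G → H` determines a morphism of temperoids `B^temp(G) → B^temp(H)` [cf.
Proposition 3.6, (iv)] whose quasi-geometricity follows by 'substituting' the equivalences of Theorem 3.7,
(iv), into Definition 3.8" (p. 42); (R3) "by varying `G'`, `H'`, we conclude that `φ` arises from a
morphism of graphs of anabelioids" (p. 43 l. 13).

PROOF-ONLY file (0 definitions) of the abc-iut cell, L-F sub-cell [SemiAnbd]+[CombGC], pack A (FACT-LIST
rows F-1717 `ProfiniteSemiGraph.InducedIsQuasiGeometric` and F-1719 `ProfiniteSemiGraph.InducesOfCompatible`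
of `TemperedReconstructionReductions.lean`; L3-lead ruling β1 (4), seat abc-iut-w6-d099).  Both named facts
are ∀-COUNTABLE typings (over every pair of graphs satisfying `Cor39Hypotheses`) of a step of a printed proof
that concerns FINITE semi-graphs.  Kernel state of the ∀-closures: F-1719 is REFUTED as typed
(`ProfiniteSemiGraph.not_inducesOfCompatible`, the chosen-conjugator reading, witness `loopGraph p`); F-1717
is conditional on the ∀-countable Thm. 3.7 (iv) `MaximalCompactIffVerticial`, itself refuted at universe
`0` (`not_maximalCompactIffVerticial`, the θ-ray), and is neither proved nor refuted as typed.  This file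
records the forms that DO hold, knitted BY NAME from the cell's per-graph ("At") closers — no new argument:

* `inducedIsQuasiGeometricAt_of_compactInVerticialAt` — the body of F-1717 at a pair `(G, H)` both
  satisfying Thm. 3.7 (iii) AT the graph (`CompactInVerticialAt`): (R0) from Thm. 3.7 (i)
  `verticialInjective_holds` and (iv) AT `G`, `H` (`maximalCompactIffVerticialAt_of_compactInVerticialAt`),
  via `InducedIsQuasiGeometric_of_at`;
* `inducedIsQuasiGeometricAt_of_finiteGraph` — the body of F-1717 at every pair of FINITE graphs,
  UNCONDITIONAL (`compactInVerticialAt_of_finiteGraph`, print's route p. 41 "the semi-graphs `𝔾_j` are all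
  finite");
* `inducedIsQuasiGeometric_of_forall_compactInVerticialAt` — the ∀-closure F-1717 reduced to Thm. 3.7 (iii)
  at the graphs of Cor. 3.9 (an honest REDUCTION: at universe `0` this hypothesis is refuted by the θ-ray,
  which satisfies `Cor39Hypotheses`; the reduction records what the typed closure rests on and nothing more);
* `Hom.inducesUpToTwist_of_compat_of_finiteGraph` / `Hom.inducesUpToTwist_iff_compat_of_finiteGraph` — the
  reading of (R3) that survives the refutation of F-1719 ("induced UP TO TWIST", `Hom.InducesUpToTwist`,
  ruling ξ2) at every pair with `H` FINITE, UNCONDITIONAL, from `Hom.inducesUpToTwist_of_compatAt`.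

HONEST FRAMING.  Instance forms of OUR typed statements of a refereed paper; nothing here bears on
[IUTchIII] Cor. 3.12, and nothing asserts abc proved or refuted.  typed ≠ proved.
-/

open CategoryTheory Topology

namespace Literature.AnabelianGeometry.SemiGraphs

namespace ProfiniteSemiGraph

universe u

variable {𝒢 ℋ : ProfiniteSemiGraph.{u}}

/-! ### (R0) — F-1717 `InducedIsQuasiGeometric`, instance forms -/

/-- **(R0) at a pair of graphs satisfying Thm. 3.7 (iii) AT the graph** ([SemiAnbd] Cor. 3.9, proof,
p. 42: "whose quasi-geometricity follows by 'substituting' the equivalences of Theorem 3.7, (iv), into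
Definition 3.8"): for `G`, `H` as in Cor. 3.9 with `CompactInVerticialAt G`, `CompactInVerticialAt H`,
a continuous `φ : π₁^temp(G) → π₁^temp(H)` compatible up to conjugation with a locally open `F : G → H` on
the verticial and the edge homomorphisms is quasi-geometric (literal Def. 3.8) — the body of the named
fact `InducedIsQuasiGeometric` (F-1717) at `(G, H)`, from Thm. 3.7 (i) `verticialInjective_holds` and
Thm. 3.7 (iv) AT `G`, `H` (`maximalCompactIffVerticialAt_of_compactInVerticialAt`).
[cite: MochizukiSemiAnbd2006, Cor 3.9 p.42] -/
theorem inducedIsQuasiGeometricAt_of_compactInVerticialAt (h𝒢iii : CompactInVerticialAt 𝒢)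
    (hℋiii : CompactInVerticialAt ℋ) (h𝒢 : Cor39Hypotheses 𝒢) (hℋ : Cor39Hypotheses ℋ)
    (c𝒢 : TemperedPiChart 𝒢) (cℋ : TemperedPiChart ℋ) (F : Hom 𝒢 ℋ) (φ : c𝒢.G →ₜ* cℋ.G)
    (hF : F.IsLocallyOpen) (hV : F.CompatV c𝒢 cℋ φ) (hE : F.CompatE c𝒢 cℋ φ) :
    IsQuasiGeometric φ :=
  InducedIsQuasiGeometric_of_at verticialInjective_holds
    (maximalCompactIffVerticialAt_of_compactInVerticialAt h𝒢iii)
    (maximalCompactIffVerticialAt_of_compactInVerticialAt hℋiii) h𝒢 hℋ c𝒢 cℋ F φ hF hV hE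

/-- **(R0) at every pair of FINITE graphs — unconditional** ([SemiAnbd] Cor. 3.9, proof, p. 42, with
Thm. 3.7 (iii) for finite semi-graphs, p. 41 "the semi-graphs `𝔾_j` are all finite"): the body of the
named fact `InducedIsQuasiGeometric` (F-1717) at every pair `(G, H)` of finite graphs as in Cor. 3.9
(`compactInVerticialAt_of_finiteGraph` at both). [cite: MochizukiSemiAnbd2006, Cor 3.9 p.42] -/
theorem inducedIsQuasiGeometricAt_of_finiteGraph [Finite 𝒢.graph.Vertex] [Finite 𝒢.graph.Edge]
    [Finite ℋ.graph.Vertex] [Finite ℋ.graph.Edge] (h𝒢 : Cor39Hypotheses 𝒢) (hℋ : Cor39Hypotheses ℋ)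
    (c𝒢 : TemperedPiChart 𝒢) (cℋ : TemperedPiChart ℋ) (F : Hom 𝒢 ℋ) (φ : c𝒢.G →ₜ* cℋ.G)
    (hF : F.IsLocallyOpen) (hV : F.CompatV c𝒢 cℋ φ) (hE : F.CompatE c𝒢 cℋ φ) :
    IsQuasiGeometric φ :=
  inducedIsQuasiGeometricAt_of_compactInVerticialAt compactInVerticialAt_of_finiteGraph
    compactInVerticialAt_of_finiteGraph h𝒢 hℋ c𝒢 cℋ F φ hF hV hE

/-- **The ∀-closure F-1717 reduced to Thm. 3.7 (iii) at the graphs of Cor. 3.9**: if every `G`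
satisfying the hypotheses of Cor. 3.9 satisfies `CompactInVerticialAt G`, then `InducedIsQuasiGeometric`.
An honest REDUCTION only: at universe `0` the hypothesis is refuted (the θ-ray of `ThetaRayRefutation.lean`
satisfies `Cor39Hypotheses`), so this records what the typed ∀-countable closure rests on; the closure
itself is neither proved nor refuted in the tree. [cite: MochizukiSemiAnbd2006, Cor 3.9 p.42] -/
theorem inducedIsQuasiGeometric_of_forall_compactInVerticialAt
    (h : ∀ 𝒢 : ProfiniteSemiGraph.{u}, Cor39Hypotheses 𝒢 → CompactInVerticialAt 𝒢) :
    InducedIsQuasiGeometric.{u} :=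
  fun 𝒢 ℋ h𝒢 hℋ c𝒢 cℋ F φ hF hV hE =>
    inducedIsQuasiGeometricAt_of_compactInVerticialAt (h 𝒢 h𝒢) (h ℋ hℋ) h𝒢 hℋ c𝒢 cℋ F φ hF hV hE

/-! ### (R3) — F-1719 `InducesOfCompatible`: the surviving reading ("up to twist") at finite `H` -/

namespace Hom

/-- **(R3), "induced UP TO TWIST", at a pair with `H` FINITE — unconditional** ([SemiAnbd] Cor. 3.9,
proof, p. 43 l. 13 "we conclude that `φ` arises from a morphism of graphs of anabelioids", read
invariantly under the 2-cells of Rmk. 2.4.2): for `G`, `H` as in Cor. 3.9 with `H` finite, a continuous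
`φ : π₁^temp(G) → π₁^temp(H)` compatible up to conjugation with a locally open `F : G → H` on the verticial
and edge homomorphisms is induced by `F` glued along SOME family of conjugating elements
(`Hom.InducesUpToTwist`; `Hom.inducesUpToTwist_of_compatAt` with `compactInVerticialAt_of_finiteGraph`).
The CHOSEN-conjugator reading `InducesOfCompatible` (F-1719) is refuted as typed
(`ProfiniteSemiGraph.not_inducesOfCompatible`). [cite: MochizukiSemiAnbd2006, Cor 3.9 p.43] -/
theorem inducesUpToTwist_of_compat_of_finiteGraph [Finite ℋ.graph.Vertex] [Finite ℋ.graph.Edge]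
    (h𝒢 : Cor39Hypotheses 𝒢) (hℋ : Cor39Hypotheses ℋ) (c𝒢 : TemperedPiChart 𝒢)
    (cℋ : TemperedPiChart ℋ) (F : Hom 𝒢 ℋ) (φ : c𝒢.G →ₜ* cℋ.G) (hF : F.IsLocallyOpen)
    (hV : F.CompatV c𝒢 cℋ φ) (hE : F.CompatE c𝒢 cℋ φ) : F.InducesUpToTwist c𝒢 cℋ φ :=
  inducesUpToTwist_of_compatAt compactInVerticialAt_of_finiteGraph h𝒢 hℋ c𝒢 cℋ F φ hF hV hE

/-- **(R3) as an `iff` at a pair with `H` FINITE — unconditional**: for a locally open `F : G → H`,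
"induced by `F` up to twist" ⟺ "compatible up to conjugation with `F` on the verticial and edge
homomorphisms" (`⇐` is the theorem above; `⇒` is (R1) for every family, hypothesis-free,
`Hom.compat_of_inducesUpToTwist`). [cite: MochizukiSemiAnbd2006, Cor 3.9 p.43] -/
theorem inducesUpToTwist_iff_compat_of_finiteGraph [Finite ℋ.graph.Vertex] [Finite ℋ.graph.Edge]
    (h𝒢 : Cor39Hypotheses 𝒢) (hℋ : Cor39Hypotheses ℋ) (c𝒢 : TemperedPiChart 𝒢)
    (cℋ : TemperedPiChart ℋ) (F : Hom 𝒢 ℋ) (φ : c𝒢.G →ₜ* cℋ.G) (hF : F.IsLocallyOpen) :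
    F.InducesUpToTwist c𝒢 cℋ φ ↔ F.CompatV c𝒢 cℋ φ ∧ F.CompatE c𝒢 cℋ φ :=
  inducesUpToTwist_iff_compatAt compactInVerticialAt_of_finiteGraph h𝒢 hℋ c𝒢 cℋ F φ hF

end Hom

end ProfiniteSemiGraph

end Literature.AnabelianGeometry.SemiGraphs
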